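import Mathlib
import HarnessLib
import Summits.Langlands.Langlands.Theorems.ExteriorSquareAscentInducedSquareAscentRegroup
import Literature.NumberTheory.Automorphic.IsobaricRigidityRepData
import Literature.NumberTheory.Automorphic.GaloisActionPlaces
import Literature.NumberTheory.Automorphic.KimExteriorSquareGL4
import Literature.NumberTheory.Automorphic.TunnellOctahedralGlobal
import Literature.NumberTheory.GaloisRepresentations.HeckeCharacter
import Literature.NumberTheory.Automorphic.ArtinLFunctionsAbelianProofs

/-!
# Auxiliary lemmas for the two analytic stubs of the Klein-cube line (crux `InducedSquareAscent`)

Shared, elementary pieces of `stub_dualityDichotomy` and `stub_kleinCubePole`: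

* limits along `t → 0⁺` (`kc_tendsto_pow_mul_zero`, `kleinHelper_poleCounting` — the three
  pole-counting contradictions of the line, stated for abstract functions with Jacquet–Shalika-type
  limits; registered helper sub-goal);
* Satake families and finite exceptional sets (`kc_exists_satakeFamily`, `kc_exists_finite_forall_not_mem`,
  `kc_prod_map_const_mul`);
* the quadratic sign as the value of a character with primitive-root values (`kc_eps_values`);
* the crux's matching hypothesis at a good place, in Satake-family form (`kc_matching_families`);
* the two `X`-set conversions on the `K`-side (`kc_selfTwist_of_X`, `kc_not_X_of_ne_one`).

Everything is proved; no named fact is used.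
-/

set_option linter.unusedVariables false
set_option linter.dupNamespace false
set_option linter.unusedSimpArgs false

noncomputable section

namespace Summit.Langlands.Langlands.Theorems.InducedSquareAscentKleinCube

open scoped Classical NumberField Topology
open Filter IsDedekindDomain NumberField
open Literature.NumberTheory.Automorphic
open Literature.NumberTheory.GaloisRepresentations (HeckeCharacter)

/-! ### Limits along `t → 0⁺` -/

/-- `t^k · F(t) → 0` as `t → 0⁺` when `F` has a finite limit and `k ≥ 1`. [folklore] -/
theorem kc_tendsto_pow_mul_zero {F : ℝ → ℂ} {c : ℂ} {k : ℕ} (hk : k ≠ 0)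
    (hF : Tendsto F (𝓝[>] (0 : ℝ)) (𝓝 c)) :
    Tendsto (fun t : ℝ => (t : ℂ) ^ k * F t) (𝓝[>] (0 : ℝ)) (𝓝 0) := by
  have h0 : Tendsto (fun t : ℝ => (t : ℂ) ^ k) (𝓝[>] (0 : ℝ)) (𝓝 0) := by
    have h1 : Tendsto (fun t : ℝ => (t : ℂ)) (𝓝[>] (0 : ℝ)) (𝓝 0) := by
      have := (Complex.continuous_ofReal.tendsto (0 : ℝ)).mono_left
        (nhdsWithin_le_nhds (s := Set.Ioi (0 : ℝ)))
      simpa using this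
    simpa [zero_pow hk] using h1.pow k
  simpa using h0.mul hF

/-- Two functions agreeing on `t > 0` agree eventually along `𝓝[>] 0`. [folklore] -/
theorem kc_eventuallyEq_of_forall_pos {f g : ℝ → ℂ} (h : ∀ t : ℝ, 0 < t → f t = g t) :
    f =ᶠ[𝓝[>] (0 : ℝ)] g :=
  eventually_nhdsWithin_of_forall fun t ht => h t ht

/-- **The three pole counts of the Klein-cube line (registered helper `kleinHelper_poleCounting`).**
Abstract form, for complex functions of a real variable `t > 0` with Jacquet–Shalika-type behaviour
at `t → 0⁺` (`t^e · L(1+t) → c ≠ 0`, `e ∈ {0, 1}` or unknown `e ∈ ℕ`):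
(1) identity (B') `A₁A₂ = Z·E·C²·B_b` with `tA₁ → c₁`, `A₂ → c₂`, `tZ → c₃`, `E → c₄`, `C → c₇`,
`t^{e_b}B_b → c₆` (all `cᵢ ≠ 0`) forces `e_b = 0`; (2) identity (A) `L_aL_b = L_dL_e` with `L_a → c₅`,
`L_b → c₆`, `tL_d → c₈ ≠ 0`, `t^{e}L_e → c₉ ≠ 0` is impossible; (3) identity (✦) `AB = Z·T·C²` with
`A → c_a`, `B → c_b`, `tZ → c_ξ ≠ 0`, `t^{e}T → c_τ ≠ 0`, `C → c₃ ≠ 0` is impossible. (Uniqueness of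
limits along the non-trivial filter `𝓝[>] 0`, and `t^k · (bounded) → 0` for `k ≥ 1`.) [folklore] -/
theorem kleinHelper_poleCounting :
    (∀ (A₁ A₂ Z E C Bb : ℝ → ℂ) (c₁ c₂ c₃ c₄ c₆ c₇ : ℂ) (eb : ℕ), c₁ ≠ 0 → c₂ ≠ 0 → c₃ ≠ 0 → c₄ ≠ 0 → c₆ ≠ 0 → c₇ ≠ 0 → Tendsto (fun t : ℝ => (t : ℂ) * A₁ t) (𝓝[>] (0 : ℝ)) (𝓝 c₁) → Tendsto A₂ (𝓝[>] (0 : ℝ)) (𝓝 c₂) → Tendsto (fun t : ℝ => (t : ℂ) * Z t) (𝓝[>] (0 : ℝ)) (𝓝 c₃) → Tendsto E (𝓝[>] (0 : ℝ)) (𝓝 c₄) → Tendsto C (𝓝[>] (0 : ℝ)) (𝓝 c₇) → Tendsto (fun t : ℝ => (t : ℂ) ^ eb * Bb t) (𝓝[>] (0 : ℝ)) (𝓝 c₆) → (∀ t : ℝ, 0 < t → A₁ t * A₂ t = Z t * E t * C t ^ 2 * Bb t) → eb = 0) ∧ (∀ (La Lb Ld Le : ℝ → ℂ) (c₅ c₆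 c₈ c₉ : ℂ) (ee : ℕ), c₈ ≠ 0 → c₉ ≠ 0 → Tendsto La (𝓝[>] (0 : ℝ)) (𝓝 c₅) → Tendsto Lb (𝓝[>] (0 : ℝ)) (𝓝 c₆) → Tendsto (fun t : ℝ => (t : ℂ) * Ld t) (𝓝[>] (0 : ℝ)) (𝓝 c₈) → Tendsto (fun t : ℝ => (t : ℂ) ^ ee * Le t) (𝓝[>] (0 : ℝ)) (𝓝 c₉) → (∀ t : ℝ, 0 < t → La t * Lb t = Ld t * Le t) → False) ∧ (∀ (A B Z T C : ℝ → ℂ) (ca cb cξ cτ c₃ : ℂ) (e : ℕ), cξ ≠ 0 → cτ ≠ 0 → c₃ ≠ 0 → Tendsto A (𝓝[>] (0 : ℝ)) (𝓝 ca) → Tendsto B (𝓝[>] (0 : ℝ)) (𝓝 cb) → Tendsto (fun t : ℝ => (t : ℂ) * Z t) (𝓝[>] (0 : ℝ)) (𝓝 cξ) → Tendsto (fun t : ℝ => (t : ℂ) ^ e * T t) (𝓝[>] (0 : ℝ)) (𝓝 cτ) → Tendsto C (𝓝[>] (0 : ℝ)) (𝓝 c₃) → (∀ t : ℝ, 0 <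 t → A t * B t = Z t * T t * C t ^ 2) → False) := by
  refine ⟨?_, ?_, ?_⟩
  · intro A₁ A₂ Z E C Bb c₁ c₂ c₃ c₄ c₆ c₇ eb hc₁ hc₂ hc₃ hc₄ hc₆ hc₇ T1 T2 T3 T4 T7 T6 hId
    by_contra heb
    have hL0 : Tendsto (fun t : ℝ => (t : ℂ) ^ (1 + eb) * (A₁ t * A₂ t)) (𝓝[>] (0 : ℝ)) (𝓝 0) := by
      refine (kc_tendsto_pow_mul_zero heb (T1.mul T2)).congr' (kc_eventuallyEq_of_forall_pos fun t _ => ?_)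
      ring
    have hR : Tendsto (fun t : ℝ => (t : ℂ) ^ (1 + eb) * (Z t * E t * C t ^ 2 * Bb t))
        (𝓝[>] (0 : ℝ)) (𝓝 (c₃ * c₄ * c₇ ^ 2 * c₆)) := by
      refine (((T3.mul T4).mul (T7.pow 2)).mul T6).congr' (kc_eventuallyEq_of_forall_pos fun t _ => ?_)
      ring
    have hR' : Tendsto (fun t : ℝ => (t : ℂ) ^ (1 + eb) * (A₁ t * A₂ t))
        (𝓝[>] (0 : ℝ)) (𝓝 (c₃ * c₄ * c₇ ^ 2 * c₆)) :=
      hR.congr' (kc_eventuallyEq_of_forall_pos fun t ht => by rw [hId t ht])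
    have := tendsto_nhds_unique hL0 hR'
    exact (mul_ne_zero (mul_ne_zero (mul_ne_zero hc₃ hc₄) (pow_ne_zero 2 hc₇)) hc₆) this.symm
  · intro La Lb Ld Le c₅ c₆ c₈ c₉ ee hc₈ hc₉ T5 T6 T8 T9 hId
    have hL0 : Tendsto (fun t : ℝ => (t : ℂ) ^ (1 + ee) * (La t * Lb t)) (𝓝[>] (0 : ℝ)) (𝓝 0) :=
      kc_tendsto_pow_mul_zero (by omega) (T5.mul T6)
    have hR : Tendsto (fun t : ℝ => (t : ℂ) ^ (1 + ee) * (Ld t * Le t)) (𝓝[>] (0 : ℝ))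
        (𝓝 (c₈ * c₉)) := by
      refine (T8.mul T9).congr' (kc_eventuallyEq_of_forall_pos fun t _ => ?_)
      ring
    have hR' : Tendsto (fun t : ℝ => (t : ℂ) ^ (1 + ee) * (La t * Lb t)) (𝓝[>] (0 : ℝ))
        (𝓝 (c₈ * c₉)) :=
      hR.congr' (kc_eventuallyEq_of_forall_pos fun t ht => by rw [hId t ht])
    exact (mul_ne_zero hc₈ hc₉) (tendsto_nhds_unique hL0 hR').symm
  · intro A B Z T C ca cb cξ cτ c₃ e hcξ hcτ hc₃ Ta Tb Tξ Tτ T3 hId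
    have hL0 : Tendsto (fun t : ℝ => (t : ℂ) ^ (1 + e) * (A t * B t)) (𝓝[>] (0 : ℝ)) (𝓝 0) :=
      kc_tendsto_pow_mul_zero (by omega) (Ta.mul Tb)
    have hR : Tendsto (fun t : ℝ => (t : ℂ) ^ (1 + e) * (Z t * T t * C t ^ 2)) (𝓝[>] (0 : ℝ))
        (𝓝 (cξ * cτ * c₃ ^ 2)) := by
      refine ((Tξ.mul Tτ).mul (T3.pow 2)).congr' (kc_eventuallyEq_of_forall_pos fun t _ => ?_)
      ring
    have hR' : Tendsto (fun t : ℝ => (t : ℂ) ^ (1 + e) * (A t * B t)) (𝓝[>] (0 : ℝ))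
        (𝓝 (cξ * cτ * c₃ ^ 2)) :=
      hR.congr' (kc_eventuallyEq_of_forall_pos fun t ht => by rw [hId t ht])
    exact (mul_ne_zero (mul_ne_zero hcξ hcτ) (pow_ne_zero 2 hc₃)) (tendsto_nhds_unique hL0 hR').symm

/-! ### Families, exceptional sets -/

/-- A Satake family for a Borel–Jacquet datum: a choice of Satake parameter at almost every place
(Flath: unramified almost everywhere, `hasSatakeParamAt_cofinite_holds`). [folklore] -/
theorem kc_exists_satakeFamily {n : ℕ} {F : Type} [Field F] [NumberField F]
    {hF : isCompact_glFiniteIntegralLevel n F} (π : AutomorphicRepData (AutomorphyDatum.gl n F hF)) :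
    ∃ α : SatakeFamily F, ∀ᶠ v : HeightOneSpectrum (𝓞 F) in cofinite, π.HasSatakeParamAt v (α v) := by
  refine ⟨fun v => if h : π.IsUnramifiedAt v then h.choose else 0, ?_⟩
  filter_upwards [π.hasSatakeParamAt_cofinite_holds] with v hv
  simp only [dif_pos hv]
  exact hv.choose_spec

/-- A cofinite-eventual property fails only on a finite set. [folklore] -/
theorem kc_exists_finite_forall_not_mem {ι : Type*} {p : ι → Prop} (h : ∀ᶠ x in cofinite, p x) :
    ∃ S : Set ι, S.Finite ∧ ∀ x ∉ S, p x :=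
  ⟨{x | ¬ p x}, Filter.eventually_cofinite.1 h, fun x hx => not_not.1 hx⟩

/-- `∏ (c • m) = c ^ card m · ∏ m`. [folklore] -/
theorem kc_prod_map_const_mul (m : Multiset ℂ) (c : ℂ) :
    (m.map (fun x => c * x)).prod = c ^ Multiset.card m * m.prod := by
  rw [Multiset.prod_map_mul, Multiset.map_const', Multiset.prod_replicate, Multiset.map_id']

/-- A place of `L` above any place of `K`. [folklore] -/
theorem kc_exists_place_over {K L : Type} [Field K] [NumberField K] [Field L] [NumberField L]
    [Algebra K L] (v : HeightOneSpectrum (𝓞 K)) :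
    ∃ w : HeightOneSpectrum (𝓞 L), w.under (𝓞 K) = v := by
  have hne0 : Nat.card {w : HeightOneSpectrum (𝓞 L) // w.under (𝓞 K) = v} ≠ 0 := by
    rw [card_placesOver (E := L) v]
    exact IsDedekindDomain.primesOver_ncard_ne_zero v.asIdeal (𝓞 L)
  obtain ⟨⟨w, hw⟩⟩ := (Nat.card_ne_zero.mp hne0).1
  exact ⟨w, hw⟩

/-! ### The quadratic sign as a character value -/

/-- **`ε(ϖ_v) = ε_{L/K}(v)`**: over a place `v` unramified in the quadratic Galois extension `L/K`,
a complex number which is a primitive `f_v`-th root of unity (`f_v` the common residue degree of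
the places above `v`) is `1` at split and `-1` at inert `v`, i.e. equals `quadraticSign L v`; in
particular it has norm `1` and is its own inverse. (Applied to the class-field character of `L/K`,
`IsClassFieldCharacter.eventually_isPrimitiveRoot_valueAtUniformizer`.) [folklore] -/
theorem kc_eps_values {K L : Type} [Field K] [NumberField K] [Field L] [NumberField L] [Algebra K L]
    [IsGalois K L] (hdeg : Module.finrank K L = 2) {τ : L ≃ₐ[K] L} (hτ : τ ≠ 1) {e : ℂ}
    {v : HeightOneSpectrum (𝓞 K)} (hunr : v.asIdeal.ramificationIdxIn (𝓞 L) = 1)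
    (hr : IsPrimitiveRoot e (v.asIdeal.inertiaDegIn (𝓞 L))) :
    (∀ w : HeightOneSpectrum (𝓞 L), w.under (𝓞 K) = v → w.asIdeal.inertiaDeg (𝓞 K) = 1 → e = 1) ∧
    (∀ w : HeightOneSpectrum (𝓞 L), w.under (𝓞 K) = v → w.asIdeal.inertiaDeg (𝓞 K) = 2 → e = -1) ∧
    e = quadraticSign L v ∧ ‖e‖ = 1 ∧ e⁻¹ = e := by
  have hsplit : ∀ w : HeightOneSpectrum (𝓞 L), w.under (𝓞 K) = v →
      w.asIdeal.inertiaDeg (𝓞 K) = 1 → e = 1 := by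
    intro w hw hf
    have hfin : v.asIdeal.inertiaDegIn (𝓞 L) = 1 := by
      rw [← hw, ← inertiaDeg_eq_inertiaDegIn_under (F := K) w, hf]
    rw [hfin] at hr
    exact IsPrimitiveRoot.one_right_iff.mp hr
  have hinert : ∀ w : HeightOneSpectrum (𝓞 L), w.under (𝓞 K) = v →
      w.asIdeal.inertiaDeg (𝓞 K) = 2 → e = -1 := by
    intro w hw hf
    have hfin : v.asIdeal.inertiaDegIn (𝓞 L) = 2 := by
      rw [← hw, ← inertiaDeg_eq_inertiaDegIn_under (F := K) w, hf]
    have hr' := hr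
    rw [hfin] at hr'
    exact hr'.eq_neg_one_of_two_right
  have hq : e = quadraticSign L v := by
    unfold quadraticSign
    by_cases hex : ∃ w : HeightOneSpectrum (𝓞 L), w.asIdeal.under (𝓞 K) = v.asIdeal ∧
        w.asIdeal.inertiaDeg (𝓞 K) = 1
    · rw [if_pos hex]
      obtain ⟨w, hw, hf⟩ := hex
      exact hsplit w (HeightOneSpectrum.ext hw) hf
    · rw [if_neg hex]
      have hex' : ¬ ∃ w : HeightOneSpectrum (𝓞 L), w.under (𝓞 K) = v ∧ w.asIdeal.inertiaDeg (𝓞 K) = 1 :=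
        fun ⟨w, hw, hf⟩ => hex ⟨w, congrArg HeightOneSpectrum.asIdeal hw, hf⟩
      obtain ⟨w, hw, hf, -⟩ := fibre_of_not_exists_inertiaDeg_eq_one hdeg hτ hunr hex'
      exact hinert w hw hf
  refine ⟨hsplit, hinert, hq, ?_, ?_⟩
  · rw [hq]; rcases quadraticSign_eq_one_or (E := L) v with h | h <;> rw [h] <;> simp
  · rw [hq]; rcases quadraticSign_eq_one_or (E := L) v with h | h <;> rw [h] <;> norm_num

/-! ### The matching hypothesis at a good place, in Satake-family form -/

/-- **The crux's matching at a good place, on Satake families.** If `P₀` has the Satake parameters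
`B w` at the places of `L` above the unramified place `v ∉ S`, the matching clause of the crux at `v`
for the parameter `a` of `π₀` reads: `∧²a = B w + B (τ • w)` for every degree-one `w ∣ v`, and
`∧²a = γ + (-γ)` with `γ² = B w`, `card γ = 3`, for every degree-two `w ∣ v` (uniqueness of Satake
parameters, and the fibre `{w, τ • w}` / `{w}`). [folklore] -/
theorem kc_matching_families {K L : Type} [Field K] [NumberField K] [Field L] [NumberField L]
    [Algebra K L] [IsGalois K L] (hdeg : Module.finrank K L = 2) {τ : L ≃ₐ[K] L} (hτ : τ ≠ 1)
    {hL3 : isCompact_glFiniteIntegralLevel 3 L} {P₀ : CuspidalAutomorphicRepData 3 L hL3}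
    (huP : P₀.1.hasSatakeParamAt_unique) {S : Set (HeightOneSpectrum (𝓞 K))} {B : SatakeFamily L}
    (sB : ∀ w : HeightOneSpectrum (𝓞 L), w.under (𝓞 K) ∉ S → P₀.1.HasSatakeParamAt w (B w))
    {v : HeightOneSpectrum (𝓞 K)} (hv : v ∉ S) (hunr : v.asIdeal.ramificationIdxIn (𝓞 L) = 1)
    {a : Multiset ℂ}
    (hm : ((∃ w : HeightOneSpectrum (𝓞 L), w.asIdeal.under (𝓞 K) = v.asIdeal ∧
            w.asIdeal.inertiaDeg (𝓞 K) = 1) →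
          ∃ w₁ w₂ : HeightOneSpectrum (𝓞 L), w₁ ≠ w₂ ∧ w₁.asIdeal.under (𝓞 K) = v.asIdeal ∧
            w₂.asIdeal.under (𝓞 K) = v.asIdeal ∧ ∃ β₁ β₂ : Multiset ℂ,
              P₀.1.HasSatakeParamAt w₁ β₁ ∧ P₀.1.HasSatakeParamAt w₂ β₂ ∧
                (a.powersetCard 2).map Multiset.prod = β₁ + β₂) ∧
        ((¬ ∃ w : HeightOneSpectrum (𝓞 L), w.asIdeal.under (𝓞 K) = v.asIdeal ∧
            w.asIdeal.inertiaDeg (𝓞 K) = 1) →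
          ∃ w : HeightOneSpectrum (𝓞 L), w.asIdeal.under (𝓞 K) = v.asIdeal ∧
            ∃ β γ : Multiset ℂ, P₀.1.HasSatakeParamAt w β ∧ γ.map (fun c => c ^ 2) = β ∧
              (a.powersetCard 2).map Multiset.prod = γ + γ.map (fun c => -c))) :
    (∀ w : HeightOneSpectrum (𝓞 L), w.under (𝓞 K) = v → w.asIdeal.inertiaDeg (𝓞 K) = 1 →
      wedgeTwoParams a = B w + B (τ • w)) ∧
    (∀ w : HeightOneSpectrum (𝓞 L), w.under (𝓞 K) = v → w.asIdeal.inertiaDeg (𝓞 K) = 2 →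
      ∃ γ : Multiset ℂ, Multiset.card γ = 3 ∧ γ.map (· ^ 2) = B w ∧
        wedgeTwoParams a = γ + γ.map (-·)) := by
  constructor
  · intro w hw hf
    obtain ⟨w₁, w₂, hne, hw₁, hw₂, β₁, β₂, hβ₁, hβ₂, hsum⟩ := hm.1 ⟨w, by rw [← hw]; rfl, hf⟩
    have hw₁' : w₁.under (𝓞 K) = v := HeightOneSpectrum.ext hw₁
    have hw₂' : w₂.under (𝓞 K) = v := HeightOneSpectrum.ext hw₂
    have h1S : w₁.under (𝓞 K) ∉ S := by rw [hw₁']; exact hv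
    have h2S : w₂.under (𝓞 K) ∉ S := by rw [hw₂']; exact hv
    have e1 : β₁ = B w₁ := huP hβ₁ (sB w₁ h1S)
    have e2 : β₂ = B w₂ := huP hβ₂ (sB w₂ h2S)
    obtain ⟨-, -, hall⟩ := fibre_of_inertiaDeg_eq_one hdeg hτ hunr hw hf
    change wedgeTwoParams a = β₁ + β₂ at hsum
    rw [hsum, e1, e2]
    rcases hall w₁ hw₁' with h₁ | h₁ <;> rcases hall w₂ hw₂' with h₂ | h₂
    · exact absurd (h₁.trans h₂.symm) hne
    · rw [h₁, h₂]
    · rw [h₁, h₂, add_comm]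
    · exact absurd (h₁.trans h₂.symm) hne
  · intro w hw hf
    have hne : ¬ ∃ w' : HeightOneSpectrum (𝓞 L), w'.asIdeal.under (𝓞 K) = v.asIdeal ∧
        w'.asIdeal.inertiaDeg (𝓞 K) = 1 := by
      rintro ⟨w', hw', hf'⟩
      have := inertiaDeg_eq_of_under_eq (K := K) (w := w) (w' := w')
        (by rw [hw]; exact HeightOneSpectrum.ext hw')
      omega
    obtain ⟨w', hw', β, γ, hβ, hγ, hsum⟩ := hm.2 hne
    have hne' : ¬ ∃ w' : HeightOneSpectrum (𝓞 L), w'.under (𝓞 K) = v ∧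
        w'.asIdeal.inertiaDeg (𝓞 K) = 1 :=
      fun ⟨w', hw', hf'⟩ => hne ⟨w', congrArg HeightOneSpectrum.asIdeal hw', hf'⟩
    obtain ⟨w₀, -, -, -, -, hall⟩ := fibre_of_not_exists_inertiaDeg_eq_one hdeg hτ hunr hne'
    have hww' : w' = w := (hall w' (HeightOneSpectrum.ext hw')).trans (hall w hw).symm
    rw [hww'] at hβ
    have hvS : w.under (𝓞 K) ∉ S := by rw [hw]; exact hv
    have e1 : β = B w := huP hβ (sB w hvS)
    refine ⟨γ, ?_, ?_, hsum⟩
    · have := congrArg Multiset.card hγ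
      rw [Multiset.card_map, e1, (sB w hvS).card_eq] at this
      exact this
    · rw [hγ, e1]

/-! ### `X`-sets on the `K`-side -/

/-- **The `X`-condition of `(π₀, π₀^∨ ⊗ ε)` is the `ε`-self-twist of `π₀`.** If at almost every
place `α v` is the Satake parameter of `π₀`, `ε(ϖ_v)` is a primitive `f_v`-th root of unity and
`α v = ((ε(ϖ_v) α v⁻¹))⁻¹` (Jacquet–Shalika's `X` at `s₀ = 1`), then `π₀` is self-twisted by the
quadratic sign of `L/K` at Satake level a.e. [folklore] -/
theorem kc_selfTwist_of_X {K L : Type} [Field K] [NumberField K] [Field L] [NumberField L]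
    [Algebra K L] [IsGalois K L] (hdeg : Module.finrank K L = 2) {τ : L ≃ₐ[K] L} (hτ : τ ≠ 1)
    {hcpt : isCompact_glFiniteIntegralLevel 4 K} {π₀ : CuspidalAutomorphicRepData 4 K hcpt}
    (huπ : π₀.1.hasSatakeParamAt_unique) {α : SatakeFamily K} {ε : HeckeCharacter K}
    (hG : ∀ᶠ v : HeightOneSpectrum (𝓞 K) in cofinite, π₀.1.HasSatakeParamAt v (α v) ∧
      IsPrimitiveRoot (ε.valueAtUniformizer v) (v.asIdeal.inertiaDegIn (𝓞 L)) ∧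
      v.asIdeal.ramificationIdxIn (𝓞 L) = 1)
    (hX : ∀ᶠ v : HeightOneSpectrum (𝓞 K) in cofinite,
      (α v).map ((((v.residueCard : ℂ) ^ (1 - (1 : ℂ)))) * ·) =
        (((α v).map (·⁻¹)).map (ε.valueAtUniformizer v * ·)).map (·⁻¹)) :
    ∀ᶠ v : HeightOneSpectrum (𝓞 K) in cofinite, ∀ a : Multiset ℂ, π₀.1.HasSatakeParamAt v a →
      a.map (fun x => quadraticSign L v * x) = a := by
  filter_upwards [hX, hG] with v hx hg a ha
  obtain ⟨-, -, hεq, -, hεi⟩ := kc_eps_values hdeg hτ hg.2.2 hg.2.1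
  have haA : a = α v := huπ ha hg.1
  have h1 : (α v).map ((((v.residueCard : ℂ) ^ (1 - (1 : ℂ)))) * ·) = α v := by
    simp only [sub_self, Complex.cpow_zero, one_mul, Multiset.map_id']
  rw [h1] at hx
  have hx' : α v = (α v).map (ε.valueAtUniformizer v * ·) := by
    calc α v = (((α v).map (·⁻¹)).map (ε.valueAtUniformizer v * ·)).map (·⁻¹) := hx
      _ = (α v).map (ε.valueAtUniformizer v * ·) := by
        simp only [Multiset.map_map, Function.comp_def, mul_inv, inv_inv, hεi]
  rw [haA, ← hεq]
  exact hx'.symm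

/-- **The `X`-condition of `(1, ε)` fails for `ε ≠ 1`** (Hecke rigidity
`ext_of_eventually_valueAtUniformizer_eq`). [folklore] -/
theorem kc_not_X_of_ne_one {K : Type} [Field K] [NumberField K] {ε : HeckeCharacter K} (hε : ε ≠ 1) :
    ¬ (1 = 1 ∧ ∀ᶠ v : HeightOneSpectrum (𝓞 K) in cofinite,
      (({1} : Multiset ℂ)).map ((((v.residueCard : ℂ) ^ (1 - (1 : ℂ)))) * ·) =
        (({ε.valueAtUniformizer v} : Multiset ℂ)).map (·⁻¹)) := by
  rintro ⟨-, hX⟩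
  apply hε
  refine HeckeCharacter.ext_of_eventually_valueAtUniformizer_eq ?_
  filter_upwards [hX] with v hx
  simp only [sub_self, Complex.cpow_zero, one_mul, Multiset.map_singleton,
    Multiset.singleton_inj] at hx
  rw [HeckeCharacter.valueAtUniformizer_one]
  exact (inv_eq_one.mp hx.symm)

end Summit.Langlands.Langlands.Theorems.InducedSquareAscentKleinCube

end
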